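import Literature.Probability.Percolation.QuadCrossingNoiseIndep
import Literature.Probability.Percolation.QuadCrossingNoiseBlack
import Literature.Probability.Percolation.QuadCrossingNoiseProofs
import Literature.Probability.Independence.IndepCondExp
import HarnessLib

/-!
# Schramm–Smirnov 2011, Cor. 1.8 from Thm. 1.7: the rectangle base is a noise, and blackness
# reduces to the pivotal estimate

Topic `Literature/Probability/Percolation`; proofs file for the named facts
`SchrammSmirnov2011_cor_1_8_noise` and `SchrammSmirnov2011_cor_1_8_black` of
`QuadCrossingNoise.lean` (O. Schramm, S. Smirnov, *On the scaling limits of planar percolation*,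
Ann. Probab. 39 (2011) 1768–1814, arXiv:1101.5820).  The source derives Cor. 1.8 ("any
subsequential scaling limit … is a noise with a Boolean base given by an appropriate algebra of
piecewise-smooth planar domains (e.g., generated by rectangles)") from Theorem 1.7
(Factorization: "`𝓕_D = 𝓕_{D∖α} = ∨_j 𝓕_{D_j}`, up to sets of measure zero", for `α` a finite
union of finite-length paths) and the product structure of the discrete model.  The independence
half is `QuadCrossingNoiseIndep.lean`; this file PROVES the remaining glue, i.e. Cor. 1.8 (noise)
as a COROLLARY of the named fact `SchrammSmirnov2011_thm_1_7`, and the factorization hypothesis of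
the blackness reduction likewise:

* `exists_frontier_subset_lines_of_mem_rectAlgebra` — a member of the rectangle base has its
  frontier on finitely many coordinate lines;
* `isFiniteLengthPathUnion_grid` — the grid cut: finitely many vertical segments
  `{re = t, c ≤ im ≤ d}` and horizontal segments `{im = s, a ≤ re ≤ b}` form a finite union of
  finite-length paths with finitely many double points (the hypothesis of Thm. 1.7);
* `subset_openBox_or_subset_compl_closedBox` — a component of `D ∖ (grid cut)` lies inside the
  open box and off the lines, or outside the closed box; with
  `subset_interior_or_subset_interior_compl_of_isPreconnected` it then lies inside `int V` or inside
  `int Vᶜ` for every `V` of the base whose frontier is on the lines;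
* `exists_ae_eq_of_thm_1_7` — **the engine**: by Thm. 1.7 for the grid cut through a box around
  `[Q]`, the crossing event `⊞_Q` is a.e. equal to an event of
  `(∨_{V ∈ J} 𝓕_{D ∩ box ∩ int V}) ∨ 𝓕_{D ∩ box ∩ ⋂_{V ∈ J} int Vᶜ} ∨ 𝓕_{D ∖ closed box}`
  for any finite family `J` of members of the base;
* `aeIncluded_borel_regionField_sup_of_thm_1_7`, `aeIncluded_regionField_union_of_thm_1_7` —
  hence (the unbounded pieces `𝓕_{D ∖ box}` being INDEPENDENT of `𝓕_{D ∩ box}` by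
  `indep_crossingField_of_disjoint`, they drop out of the conditioning:
  `exists_measurableSet_ae_eq_of_indep`) the Borel `σ`-field is `𝓕_{int(D ∩ W)} ∨ 𝓕_{int(D ∖ W)}`
  mod `μ`, and `𝓕_{int(D ∩ (V ∪ W))} ⊆ 𝓕_{int(D ∩ V)} ∨ 𝓕_{int(D ∩ W)}` mod `μ`, for `V, W` in
  the base — also for UNBOUNDED `D` and unbounded members of the base (half-planes), where the
  frontier is not a finite-length cut and Thm. 1.7 does not apply verbatim;
* `SchrammSmirnov2011_cor_1_8_noise_of_thm_1_7` — **Cor. 1.8 (noise) from Thm. 1.7**;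
* `SchrammSmirnov2011_cor_1_8_black_of_thm_1_7` — **Cor. 1.8 (black) from Thm. 1.7 and the
  pivotal estimate** (hypothesis 3 of `SchrammSmirnov2011_cor_1_8_black_of_noise`, Tsirelson's
  "`o(ε²)` each": the four-arm and boundary three-arm bounds transported to the limit), the only
  input of the blackness corollary that is not a consequence of Thm. 1.7.

No definition and no named fact is introduced (D-0026).

## References

* O. Schramm, S. Smirnov, Ann. Probab. 39 (2011) 1768–1814, arXiv:1101.5820: Thm. 1.7, Cor. 1.8,
  proof of Thm. 1.7 (p. 21). [SchrammSmirnov2011]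
* B. Tsirelson, *Noise as a Boolean algebra of `σ`-fields*, Ann. Probab. 42 (2014), Def. 1.1, §1.6
  (measure factorizations). [Tsirelson2014]
* D. Williams, *Probability with Martingales* (1991), §9.7 (k) (an independent `σ`-field drops
  out of the conditioning).
-/

noncomputable section

open scoped Topology unitInterval
open Set Filter Metric
open _root_.MeasureTheory _root_.ProbabilityTheory
open Literature.Probability.Independence

namespace Literature.Probability.Percolation

namespace QuadCrossing

variable {D : Set ℂ}

/-! ### Frontiers of members of the rectangle base -/

/-- **A member of the rectangle base has its frontier on finitely many coordinate lines**
(`{re = t}`, `t ∈ A`, and `{im = s}`, `s ∈ B`): true for the generating half-planes, preserved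
under complement (`frontier sᶜ = frontier s`) and finite union
(`frontier (s ∪ t) ⊆ frontier s ∪ frontier t`). [folklore] -/
theorem exists_frontier_subset_lines_of_mem_rectAlgebra {W : Set ℂ} (hW : W ∈ rectAlgebra) :
    ∃ A B : Finset ℝ, frontier W ⊆ {z : ℂ | z.re ∈ A} ∪ {z : ℂ | z.im ∈ B} := by
  classical
  induction hW with
  | base s hs =>
    rcases hs with ⟨a, rfl⟩ | ⟨a, rfl⟩
    · refine ⟨{a}, ∅, fun z hz => Or.inl ?_⟩
      have h := frontier_lt_subset_eq Complex.continuous_re continuous_const hz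
      simpa using h
    · refine ⟨∅, {a}, fun z hz => Or.inr ?_⟩
      have h := frontier_lt_subset_eq Complex.continuous_im continuous_const hz
      simpa using h
  | empty => exact ⟨∅, ∅, by simp⟩
  | compl s _ ih => simpa only [frontier_compl] using ih
  | union s t _ _ ihs iht =>
    obtain ⟨A, B, h⟩ := ihs
    obtain ⟨A', B', h'⟩ := iht
    refine ⟨A ∪ A', B ∪ B', fun z hz => ?_⟩
    rcases frontier_union_subset s t hz with ⟨hz, -⟩ | ⟨-, hz⟩
    · rcases h hz with hz | hz
      · exact Or.inl (by simp only [mem_setOf_eq, Finset.mem_union] at hz ⊢; exact Or.inl hz)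
      · exact Or.inr (by simp only [mem_setOf_eq, Finset.mem_union] at hz ⊢; exact Or.inl hz)
    · rcases h' hz with hz | hz
      · exact Or.inl (by simp only [mem_setOf_eq, Finset.mem_union] at hz ⊢; exact Or.inr hz)
      · exact Or.inr (by simp only [mem_setOf_eq, Finset.mem_union] at hz ⊢; exact Or.inr hz)

/-! ### The grid cut is a finite union of finite-length paths -/

/-- The inclusion `[0,1] → ℝ` has bounded variation (it is monotone). [folklore] -/
theorem boundedVariationOn_unitInterval_coe :
    BoundedVariationOn (fun u : I => (u : ℝ)) univ := by
  have hmono : MonotoneOn (fun u : I => (u : ℝ)) univ := fun x _ y _ h => h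
  have h := hmono.eVariationOn_le (a := 0) (b := 1) (mem_univ _) (mem_univ _)
  have huniv : (univ : Set I) ∩ Icc 0 1 = univ := by
    ext u
    simp only [mem_inter_iff, mem_univ, mem_Icc, true_and, iff_true]
    exact ⟨Subtype.coe_le_coe.1 u.2.1, Subtype.coe_le_coe.1 u.2.2⟩
  rw [huniv] at h
  exact ne_top_of_le_ne_top ENNReal.ofReal_ne_top h

/-- A path `[0,1] → ℂ` that factors through a Lipschitz map of `ℝ` (e.g. an affine segment) has
finite length: the parameter has bounded variation. [folklore] -/
theorem boundedVariationOn_comp_coe_of_lipschitz (f : ℝ → ℂ) {K : NNReal}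
    (hf : LipschitzWith K f) : BoundedVariationOn (fun u : I => f u) univ :=
  hf.comp_boundedVariationOn boundedVariationOn_unitInterval_coe

/-- **The grid cut** — the vertical segments `{re = t, c ≤ im ≤ d}`, `t ∈ A`, together with the
horizontal segments `{im = s, a ≤ re ≤ b}`, `s ∈ B` (`a < b`, `c < d`) — **is a finite union of
finite-length paths with finitely many double points** (the hypothesis on `α` in Thm. 1.7):
each segment is an affine path, distinct parallel segments are disjoint, and a vertical and a
horizontal segment meet in at most the one point `t + s i`. [cite: SchrammSmirnov2011, Thm. 1.7 (hypothesis on α)] -/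
theorem isFiniteLengthPathUnion_grid (A B : Finset ℝ) {a b c d : ℝ} (hab : a < b) (hcd : c < d) :
    IsFiniteLengthPathUnion
      ((⋃ t ∈ A, {z : ℂ | z.re = t ∧ c ≤ z.im ∧ z.im ≤ d}) ∪
        ⋃ s ∈ B, {z : ℂ | z.im = s ∧ a ≤ z.re ∧ z.re ≤ b}) := by
  classical
  -- the affine parametrisations
  set fv : ℝ → ℝ → ℂ := fun t x => (t : ℂ) + ((c + x * (d - c) : ℝ) : ℂ) * Complex.I with hfv
  set fh : ℝ → ℝ → ℂ := fun s x => ((a + x * (b - a) : ℝ) : ℂ) + (s : ℂ) * Complex.I with hfh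
  have fv_re : ∀ t x, (fv t x).re = t := fun t x => by simp [hfv]
  have fv_im : ∀ t x, (fv t x).im = c + x * (d - c) := fun t x => by simp [hfv]
  have fh_re : ∀ s x, (fh s x).re = a + x * (b - a) := fun s x => by simp [hfh]
  have fh_im : ∀ s x, (fh s x).im = s := fun s x => by simp [hfh]
  have hcv : ∀ t, Continuous (fv t) := fun t => by simp only [hfv]; fun_prop
  have hch : ∀ s, Continuous (fh s) := fun s => by simp only [hfh]; fun_prop
  -- the paths, indexed by `A ⊕ B`, reindexed by `Fin n`
  set γ' : (A ⊕ B : Type) → C(I, ℂ) :=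
    Sum.elim (fun t => ⟨fun u => fv t u, (hcv t).comp continuous_subtype_val⟩)
      (fun s => ⟨fun u => fh s u, (hch s).comp continuous_subtype_val⟩) with hγ'
  have γ'_inl : ∀ (t : A) (u : I), γ' (Sum.inl t) u = fv t u := fun t u => rfl
  have γ'_inr : ∀ (s : B) (u : I), γ' (Sum.inr s) u = fh s u := fun s u => rfl
  set e := Fintype.equivFin (A ⊕ B : Type) with he
  -- ranges of the paths
  have range_v : ∀ t : ℝ,
      range (fun u : I => fv t u) = {z : ℂ | z.re = t ∧ c ≤ z.im ∧ z.im ≤ d} := by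
    intro t
    ext z
    constructor
    · rintro ⟨u, rfl⟩
      refine ⟨fv_re t u, ?_, ?_⟩
      · rw [fv_im]; nlinarith [u.2.1, u.2.2]
      · rw [fv_im]; nlinarith [u.2.1, u.2.2]
    · rintro ⟨hre, h1, h2⟩
      have hdc : 0 < d - c := sub_pos.2 hcd
      refine ⟨⟨(z.im - c) / (d - c), div_nonneg (by linarith) hdc.le,
        (div_le_one hdc).2 (by linarith)⟩, ?_⟩
      apply Complex.ext
      · rw [fv_re, hre]
      · rw [fv_im]; field_simp; ring
  have range_h : ∀ s : ℝ,
      range (fun u : I => fh s u) = {z : ℂ | z.im = s ∧ a ≤ z.re ∧ z.re ≤ b} := by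
    intro s
    ext z
    constructor
    · rintro ⟨u, rfl⟩
      refine ⟨fh_im s u, ?_, ?_⟩
      · rw [fh_re]; nlinarith [u.2.1, u.2.2]
      · rw [fh_re]; nlinarith [u.2.1, u.2.2]
    · rintro ⟨him, h1, h2⟩
      have hba : 0 < b - a := sub_pos.2 hab
      refine ⟨⟨(z.re - a) / (b - a), div_nonneg (by linarith) hba.le,
        (div_le_one hba).2 (by linarith)⟩, ?_⟩
      apply Complex.ext
      · rw [fh_re]; field_simp; ring
      · rw [fh_im, him]
  refine ⟨Fintype.card (A ⊕ B : Type), γ' ∘ e.symm, ?_, ?_, ?_⟩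
  · -- the union of the ranges is the grid
    show _ = ⋃ i, range ⇑(γ' (e.symm i))
    rw [e.symm.surjective.iUnion_comp (fun j => range ⇑(γ' j)), iUnion_sum]
    congr 1
    · rw [iUnion_subtype]
      exact (iUnion₂_congr fun t _ => range_v t).symm
    · rw [iUnion_subtype]
      exact (iUnion₂_congr fun s _ => range_h s).symm
  · -- finite length
    intro i
    have hlip_v : ∀ t : ℝ, LipschitzWith (Real.nnabs (d - c)) (fv t) := fun t =>
      LipschitzWith.of_dist_le_mul fun x y => by
        rw [dist_eq_norm, dist_eq_norm, Real.coe_nnabs]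
        have : fv t x - fv t y = (((x - y) * (d - c) : ℝ) : ℂ) * Complex.I := by
          simp only [hfv]; push_cast; ring
        rw [this, norm_mul, Complex.norm_I, mul_one, Complex.norm_real, Real.norm_eq_abs,
          abs_mul, Real.norm_eq_abs, mul_comm]
    have hlip_h : ∀ s : ℝ, LipschitzWith (Real.nnabs (b - a)) (fh s) := fun s =>
      LipschitzWith.of_dist_le_mul fun x y => by
        rw [dist_eq_norm, dist_eq_norm, Real.coe_nnabs]
        have : fh s x - fh s y = (((x - y) * (b - a) : ℝ) : ℂ) := by
          simp only [hfh]; push_cast; ring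
        rw [this, Complex.norm_real, Real.norm_eq_abs, abs_mul, Real.norm_eq_abs, mul_comm]
    rcases hj : e.symm i with t | s
    · have : ⇑((γ' ∘ e.symm) i) = fun u : I => fv t u := by
        funext u; simp only [Function.comp_apply, hj, γ'_inl]
      rw [this]
      exact boundedVariationOn_comp_coe_of_lipschitz _ (hlip_v t)
    · have : ⇑((γ' ∘ e.symm) i) = fun u : I => fh s u := by
        funext u; simp only [Function.comp_apply, hj, γ'_inr]
      rw [this]
      exact boundedVariationOn_comp_coe_of_lipschitz _ (hlip_h s)
  · -- finitely many double points: they lie on the lattice `A + B i`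
    refine (((A ×ˢ B).image fun p : ℝ × ℝ => (p.1 : ℂ) + (p.2 : ℂ) * Complex.I).finite_toSet).subset
      ?_
    rintro z ⟨p, q, hpq, hpz, hqz⟩
    simp only [Function.comp_apply] at hpz hqz
    simp only [Finset.coe_image, Finset.coe_product, mem_image, mem_prod, Finset.mem_coe,
      Prod.exists]
    have hdc : d - c ≠ 0 := (sub_pos.2 hcd).ne'
    have hba : b - a ≠ 0 := (sub_pos.2 hab).ne'
    -- injectivity of each path
    have inj_v : ∀ (t : ℝ) (u u' : I), fv t u = fv t u' → u = u' := fun t u u' h => by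
      have him := congrArg Complex.im h
      rw [fv_im, fv_im] at him
      exact Subtype.ext (mul_right_cancel₀ hdc (by linarith))
    have inj_h : ∀ (s : ℝ) (u u' : I), fh s u = fh s u' → u = u' := fun s u u' h => by
      have hre := congrArg Complex.re h
      rw [fh_re, fh_re] at hre
      exact Subtype.ext (mul_right_cancel₀ hba (by linarith))
    -- a point on a vertical and on a horizontal segment is a lattice point
    have cross : ∀ (t : A) (s : B) (u u' : I), fv t u = z → fh s u' = z →
        ∃ x y, (x ∈ A ∧ y ∈ B) ∧ (x : ℂ) + (y : ℂ) * Complex.I = z := by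
      intro t s u u' h1 h2
      refine ⟨t, s, ⟨t.2, s.2⟩, Complex.ext ?_ ?_⟩
      · have := congrArg Complex.re h1; rw [fv_re] at this; simp [this]
      · have := congrArg Complex.im h2; rw [fh_im] at this; simp [this]
    by_cases hj : e.symm p.1 = e.symm q.1
    · -- same path: injectivity contradicts `p ≠ q`
      exfalso
      have h1 : p.1 = q.1 := e.symm.injective hj
      apply hpq
      refine Prod.ext h1 ?_
      rcases hq : e.symm q.1 with t | s
      · rw [h1, hq, γ'_inl] at hpz
        rw [hq, γ'_inl] at hqz
        exact inj_v t _ _ (hpz.trans hqz.symm)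
      · rw [h1, hq, γ'_inr] at hpz
        rw [hq, γ'_inr] at hqz
        exact inj_h s _ _ (hpz.trans hqz.symm)
    · rcases hp : e.symm p.1 with t | s <;> rcases hq : e.symm q.1 with t' | s'
      · -- two distinct vertical segments are disjoint
        exfalso
        rw [hp, γ'_inl] at hpz
        rw [hq, γ'_inl] at hqz
        have h1 := congrArg Complex.re hpz
        have h2 := congrArg Complex.re hqz
        rw [fv_re] at h1 h2
        apply hj
        rw [hp, hq, Sum.inl.injEq]
        exact Subtype.ext (h1.trans h2.symm)
      · rw [hp, γ'_inl] at hpz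
        rw [hq, γ'_inr] at hqz
        exact cross t s' _ _ hpz hqz
      · rw [hp, γ'_inr] at hpz
        rw [hq, γ'_inl] at hqz
        exact cross t' s _ _ hqz hpz
      · exfalso
        rw [hp, γ'_inr] at hpz
        rw [hq, γ'_inr] at hqz
        have h1 := congrArg Complex.im hpz
        have h2 := congrArg Complex.im hqz
        rw [fh_im] at h1 h2
        apply hj
        rw [hp, hq, Sum.inr.injEq]
        exact Subtype.ext (h1.trans h2.symm)

/-! ### Components of the complement of the grid cut -/

/-- A preconnected set missing the frontier of `V` lies inside `int V` or inside `int Vᶜ`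
(the plane is `int V ∪ ∂V ∪ int Vᶜ`). [folklore] -/
theorem subset_interior_or_subset_interior_compl_of_isPreconnected {X : Type*}
    [TopologicalSpace X] {C V : Set X} (hC : IsPreconnected C) (h : Disjoint C (frontier V)) :
    C ⊆ interior V ∨ C ⊆ interior Vᶜ := by
  refine hC.subset_or_subset isOpen_interior isOpen_interior
    (disjoint_compl_right.mono interior_subset interior_subset) fun z hz => ?_
  by_cases hzc : z ∈ closure V
  · rw [closure_eq_interior_union_frontier] at hzc
    rcases hzc with hzc | hzc
    · exact Or.inl hzc
    · exact absurd hzc (Set.disjoint_left.1 h hz)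
  · rw [interior_compl]
    exact Or.inr hzc

/-- The closed box minus the open box (the boundary rectangle) lies on the grid cut as soon as the
grid contains the four sides (`a, b ∈ A`, `c, d ∈ B`). [folklore] -/
theorem closedBox_diff_openBox_subset_grid {A B : Finset ℝ} {a b c d : ℝ} (ha : a ∈ A) (hb : b ∈ A)
    (hc : c ∈ B) (hd : d ∈ B) :
    {z : ℂ | a ≤ z.re ∧ z.re ≤ b ∧ c ≤ z.im ∧ z.im ≤ d} \
        {z : ℂ | a < z.re ∧ z.re < b ∧ c < z.im ∧ z.im < d} ⊆
      (⋃ t ∈ A, {z : ℂ | z.re = t ∧ c ≤ z.im ∧ z.im ≤ d}) ∪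
        ⋃ s ∈ B, {z : ℂ | z.im = s ∧ a ≤ z.re ∧ z.re ≤ b} := by
  rintro z ⟨⟨h1, h2, h3, h4⟩, hz⟩
  simp only [mem_setOf_eq, not_and_or, not_lt] at hz
  simp only [mem_union, mem_iUnion, mem_setOf_eq, exists_prop]
  rcases hz with hz | hz | hz | hz
  · exact Or.inl ⟨a, ha, le_antisymm hz h1, h3, h4⟩
  · exact Or.inl ⟨b, hb, le_antisymm h2 hz, h3, h4⟩
  · exact Or.inr ⟨c, hc, le_antisymm hz h3, h1, h2⟩
  · exact Or.inr ⟨d, hd, le_antisymm h4 hz, h1, h2⟩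

/-- The open box is open. [folklore] -/
theorem isOpen_openBox (a b c d : ℝ) :
    IsOpen {z : ℂ | a < z.re ∧ z.re < b ∧ c < z.im ∧ z.im < d} :=
  (isOpen_lt continuous_const Complex.continuous_re).inter
    ((isOpen_lt Complex.continuous_re continuous_const).inter
      ((isOpen_lt continuous_const Complex.continuous_im).inter
        (isOpen_lt Complex.continuous_im continuous_const)))

/-- The closed box is closed. [folklore] -/
theorem isClosed_closedBox (a b c d : ℝ) :
    IsClosed {z : ℂ | a ≤ z.re ∧ z.re ≤ b ∧ c ≤ z.im ∧ z.im ≤ d} :=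
  (isClosed_le continuous_const Complex.continuous_re).inter
    ((isClosed_le Complex.continuous_re continuous_const).inter
      ((isClosed_le continuous_const Complex.continuous_im).inter
        (isClosed_le Complex.continuous_im continuous_const)))

/-- **Where a component of `D ∖ (grid cut)` can lie.**  If the grid contains the four sides of the
box, a preconnected subset `C` of the complement of the grid containing no boundary point of the
box lies either inside the open box — and then off every full line `{re = t}`, `t ∈ A`,
`{im = s}`, `s ∈ B` — or outside the closed box. [folklore] -/
theorem subset_openBox_or_subset_compl_closedBox {A B : Finset ℝ} {a b c d : ℝ} (ha : a ∈ A)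
    (hb : b ∈ A) (hc : c ∈ B) (hd : d ∈ B) {C : Set ℂ} (hC : IsPreconnected C)
    (hCα : Disjoint C ((⋃ t ∈ A, {z : ℂ | z.re = t ∧ c ≤ z.im ∧ z.im ≤ d}) ∪
      ⋃ s ∈ B, {z : ℂ | z.im = s ∧ a ≤ z.re ∧ z.re ≤ b})) :
    (C ⊆ {z : ℂ | a < z.re ∧ z.re < b ∧ c < z.im ∧ z.im < d} ∧
        (∀ t ∈ A, ∀ z ∈ C, z.re ≠ t) ∧ ∀ s ∈ B, ∀ z ∈ C, z.im ≠ s) ∨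
      C ⊆ {z : ℂ | a ≤ z.re ∧ z.re ≤ b ∧ c ≤ z.im ∧ z.im ≤ d}ᶜ := by
  have hcover : C ⊆ {z : ℂ | a < z.re ∧ z.re < b ∧ c < z.im ∧ z.im < d} ∪
      {z : ℂ | a ≤ z.re ∧ z.re ≤ b ∧ c ≤ z.im ∧ z.im ≤ d}ᶜ := by
    intro z hz
    by_cases h1 : z ∈ {z : ℂ | a ≤ z.re ∧ z.re ≤ b ∧ c ≤ z.im ∧ z.im ≤ d}
    · by_cases h2 : z ∈ {z : ℂ | a < z.re ∧ z.re < b ∧ c < z.im ∧ z.im < d}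
      · exact Or.inl h2
      · exact absurd (closedBox_diff_openBox_subset_grid ha hb hc hd ⟨h1, h2⟩)
          (Set.disjoint_left.1 hCα hz)
    · exact Or.inr h1
  rcases hC.subset_or_subset (isOpen_openBox a b c d) (isClosed_closedBox a b c d).isOpen_compl
    (Set.disjoint_left.2 fun z hz hz' => hz' ⟨hz.1.le, hz.2.1.le, hz.2.2.1.le, hz.2.2.2.le⟩)
    hcover with h | h
  · refine Or.inl ⟨h, fun t ht z hz hzt => ?_, fun s hs z hz hzs => ?_⟩
    · refine Set.disjoint_left.1 hCα hz (Or.inl ?_)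
      simp only [mem_iUnion, mem_setOf_eq, exists_prop]
      exact ⟨t, ht, hzt, (h hz).2.2.1.le, (h hz).2.2.2.le⟩
    · refine Set.disjoint_left.1 hCα hz (Or.inr ?_)
      simp only [mem_iUnion, mem_setOf_eq, exists_prop]
      exact ⟨s, hs, hzs, (h hz).1.le, (h hz).2.1.le⟩
  · exact Or.inr h

/-- A preconnected set inside the open box and off the full lines through `A`, `B` lies inside
`int V` or inside `int Vᶜ` for every `V` whose frontier is on those lines. [folklore] -/
theorem subset_interior_or_of_frontier_subset_lines {A B : Finset ℝ} {C V : Set ℂ}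
    (hC : IsPreconnected C) (hA : ∀ t ∈ A, ∀ z ∈ C, z.re ≠ t) (hB : ∀ s ∈ B, ∀ z ∈ C, z.im ≠ s)
    (hV : frontier V ⊆ {z : ℂ | z.re ∈ A} ∪ {z : ℂ | z.im ∈ B}) :
    C ⊆ interior V ∨ C ⊆ interior Vᶜ := by
  refine subset_interior_or_subset_interior_compl_of_isPreconnected hC
    (Set.disjoint_left.2 fun z hz hzV => ?_)
  rcases hV hzV with h | h
  · exact hA z.re h z hz rfl
  · exact hB z.im h z hz rfl

/-! ### The engine: Theorem 1.7 for the grid cut through a box around a quad -/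

/-- **Theorem 1.7 applied to the grid cut.**  Let `J` be a finite family of members of the
rectangle base and `Q` a quad of `D` (`D` open connected, `μ` a subsequential scaling limit).
There is a box `(a, b) × (c, d) ⊇ [Q]` such that, cutting `D` along the sides of the closed box
and along the coordinate lines carrying the frontiers of the members of `J` (clipped to the box:
a finite union of finite-length paths, `isFiniteLengthPathUnion_grid`), Theorem 1.7 makes `⊞_Q`
a.e. equal to an event of `∨_j 𝓕_{D_j}` over the components `D_j` of the complement of the cut;
and every such component lies in `D ∩ box ∩ int V` for some `V ∈ J`, or in
`D ∩ box ∩ ⋂_{V ∈ J} int Vᶜ`, or in `D ∖ (closed box)` (`subset_openBox_or_subset_compl_closedBox`,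
`subset_interior_or_of_frontier_subset_lines`). [cite: SchrammSmirnov2011, Thm. 1.7 and proof of Cor. 1.8] -/
theorem exists_ae_eq_of_thm_1_7 (h17 : SchrammSmirnov2011_thm_1_7) (hD : IsOpen D)
    (hDc : IsConnected D) {μ : FiniteMeasure (QuadConfig D)} (hμ : IsSubseqQuadLimit D μ)
    (J : Finset (Set ℂ)) (hJ : ∀ V ∈ J, V ∈ rectAlgebra) (Q : Quad D) :
    ∃ a b c d : ℝ, a < b ∧ c < d ∧
      Q.carrier ⊆ {z : ℂ | a < z.re ∧ z.re < b ∧ c < z.im ∧ z.im < d} ∧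
      ∃ t : Set (QuadConfig D),
        MeasurableSet[((⨆ V ∈ J, crossingField (D := D)
              (D ∩ {z : ℂ | a < z.re ∧ z.re < b ∧ c < z.im ∧ z.im < d} ∩ interior V)) ⊔
            crossingField (D := D) (D ∩ {z : ℂ | a < z.re ∧ z.re < b ∧ c < z.im ∧ z.im < d} ∩
              ⋂ V ∈ J, interior Vᶜ)) ⊔
          crossingField (D := D) (D \ {z : ℂ | a ≤ z.re ∧ z.re ≤ b ∧ c ≤ z.im ∧ z.im ≤ d})] t ∧
        QuadConfig.crossedEvent Q =ᵐ[(μ : Measure (QuadConfig D))] t := by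
  classical
  -- the coordinate lines carrying the frontiers of the members of `J`
  choose! fA fB hf using fun V (hV : V ∈ J) =>
    exists_frontier_subset_lines_of_mem_rectAlgebra (hJ V hV)
  -- a box around `[Q]`
  obtain ⟨r, hr⟩ := Q.isCompact_carrier.isBounded.subset_ball 0
  set R : ℝ := |r| + 1 with hR
  have hR0 : 0 < R := by positivity
  have hQbox : Q.carrier ⊆ {z : ℂ | -R < z.re ∧ z.re < R ∧ -R < z.im ∧ z.im < R} := by
    intro z hz
    have hzr : ‖z‖ < |r| := by
      have h := hr hz
      rw [mem_ball, dist_zero_right] at h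
      exact h.trans_le (le_abs_self r)
    have h1 := (abs_lt.1 ((Complex.abs_re_le_norm z).trans_lt hzr))
    have h2 := (abs_lt.1 ((Complex.abs_im_le_norm z).trans_lt hzr))
    exact ⟨by linarith [h1.1], by linarith [h1.2], by linarith [h2.1], by linarith [h2.2]⟩
  -- the grid cut
  set A : Finset ℝ := insert (-R) (insert R (J.biUnion fA)) with hA
  set B : Finset ℝ := insert (-R) (insert R (J.biUnion fB)) with hB
  have haA : -R ∈ A := Finset.mem_insert_self _ _
  have hbA : R ∈ A := Finset.mem_insert_of_mem (Finset.mem_insert_self _ _)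
  have hcB : -R ∈ B := Finset.mem_insert_self _ _
  have hdB : R ∈ B := Finset.mem_insert_of_mem (Finset.mem_insert_self _ _)
  have hfA : ∀ V ∈ J, frontier V ⊆ {z : ℂ | z.re ∈ A} ∪ {z : ℂ | z.im ∈ B} := by
    intro V hV z hz
    rcases hf V hV hz with h | h
    · left
      exact Finset.mem_insert_of_mem (Finset.mem_insert_of_mem
        (Finset.mem_biUnion.2 ⟨V, hV, h⟩))
    · right
      exact Finset.mem_insert_of_mem (Finset.mem_insert_of_mem
        (Finset.mem_biUnion.2 ⟨V, hV, h⟩))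
  set α : Set ℂ := (⋃ t ∈ A, {z : ℂ | z.re = t ∧ -R ≤ z.im ∧ z.im ≤ R}) ∪
    ⋃ s ∈ B, {z : ℂ | z.im = s ∧ -R ≤ z.re ∧ z.re ≤ R} with hα
  have hαfl : IsFiniteLengthPathUnion α :=
    isFiniteLengthPathUnion_grid A B (by linarith) (by linarith)
  -- Theorem 1.7
  obtain ⟨t, ht, hQt⟩ := h17 D hD hDc μ hμ α hαfl _ (QuadConfig.measurableSet_crossedEvent Q)
  suffices hle : (⨆ x ∈ D \ α, crossingField (D := D) (connectedComponentIn (D \ α) x)) ≤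
      ((⨆ V ∈ J, crossingField (D := D)
            (D ∩ {z : ℂ | -R < z.re ∧ z.re < R ∧ -R < z.im ∧ z.im < R} ∩ interior V)) ⊔
          crossingField (D := D) (D ∩ {z : ℂ | -R < z.re ∧ z.re < R ∧ -R < z.im ∧ z.im < R} ∩
            ⋂ V ∈ J, interior Vᶜ)) ⊔
        crossingField (D := D) (D \ {z : ℂ | -R ≤ z.re ∧ z.re ≤ R ∧ -R ≤ z.im ∧ z.im ≤ R}) from
    ⟨-R, R, -R, R, by linarith, by linarith, hQbox, t, hle t ht, hQt⟩
  refine iSup₂_le fun x hx => ?_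
  -- where the component of `x` lies
  have hC : IsPreconnected (connectedComponentIn (D \ α) x) := isPreconnected_connectedComponentIn
  have hCsub : connectedComponentIn (D \ α) x ⊆ D \ α := connectedComponentIn_subset _ _
  have hCD : connectedComponentIn (D \ α) x ⊆ D := hCsub.trans sdiff_subset
  have hCα : Disjoint (connectedComponentIn (D \ α) x) α :=
    Set.disjoint_left.2 fun z hz => (hCsub hz).2
  rcases subset_openBox_or_subset_compl_closedBox haA hbA hcB hdB hC hCα with
    ⟨hbox, hAre, hBim⟩ | hout
  · by_cases hex : ∃ V ∈ J, connectedComponentIn (D \ α) x ⊆ interior V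
    · obtain ⟨V, hV, hCV⟩ := hex
      refine le_trans ?_ (le_sup_left.trans le_sup_left)
      exact (crossingField_mono (subset_inter (subset_inter hCD hbox) hCV)).trans
        (le_iSup₂ (f := fun V (_ : V ∈ J) => crossingField (D := D)
          (D ∩ {z : ℂ | -R < z.re ∧ z.re < R ∧ -R < z.im ∧ z.im < R} ∩ interior V)) V hV)
    · push Not at hex
      have hall : ∀ V ∈ J, connectedComponentIn (D \ α) x ⊆ interior Vᶜ := fun V hV =>
        (subset_interior_or_of_frontier_subset_lines hC hAre hBim (hfA V hV)).resolve_left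
          (hex V hV)
      refine le_trans (crossingField_mono ?_) (le_sup_right.trans le_sup_left)
      exact subset_inter (subset_inter hCD hbox) (subset_iInter₂ hall)
  · exact le_trans (crossingField_mono (subset_sdiff.2 ⟨hCD, Set.disjoint_left.2 fun z hz hz' =>
      hout hz hz'⟩)) le_sup_right

/-! ### Cor. 1.8 from Thm. 1.7 -/

/-- **The generation half of Cor. 1.8 from Thm. 1.7** (also for unbounded `D` and unbounded
members `W` of the base): for `D` open connected, `μ` a subsequential scaling limit and
`W ∈ rectAlgebra`, the Borel `σ`-field of `ℋ_D` is `𝓕_{int(D ∩ W)} ∨ 𝓕_{int(D ∖ W)}` up to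
`μ`-null sets.  By Thm. 1.4 (2) it suffices to treat a crossing event `⊞_Q`; by the engine it is
a.e. in `(𝓕_{D ∩ box ∩ int W} ∨ 𝓕_{D ∩ box ∩ int Wᶜ}) ∨ 𝓕_{D ∖ box}`, and the last field, being
independent of `𝓕_{D ∩ box} ∋ ⊞_Q` (`indep_crossingField_of_disjoint`), drops out
(`exists_measurableSet_ae_eq_of_indep`). [cite: SchrammSmirnov2011, Cor. 1.8 (from Thm. 1.7)] -/
theorem aeIncluded_borel_regionField_sup_of_thm_1_7 (h17 : SchrammSmirnov2011_thm_1_7)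
    (hD : IsOpen D) (hDc : IsConnected D) {μ : FiniteMeasure (QuadConfig D)}
    (hμ : IsSubseqQuadLimit D μ) {W : Set ℂ} (hW : W ∈ rectAlgebra) :
    AEIncluded (μ : Measure (QuadConfig D)) (inferInstance : MeasurableSpace (QuadConfig D))
      (regionField D W ⊔ regionField D Wᶜ) := by
  classical
  haveI : IsProbabilityMeasure (μ : Measure (QuadConfig D)) :=
    isProbabilityMeasure_of_isSubseqQuadLimit hD hμ
  have hne : D.Nonempty := hDc.nonempty
  have hle : (inferInstance : MeasurableSpace (QuadConfig D)) ≤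
      QuadConfig.crossingSubfield (D := D) univ :=
    le_of_eq
      (QuadConfig.crossingSubfield_univ_eq_borel SchrammSmirnov2011_thm_1_4_holds hD hne).symm
  suffices h : AEIncluded (μ : Measure (QuadConfig D)) (QuadConfig.crossingSubfield (D := D) univ)
      (regionField D W ⊔ regionField D Wᶜ) from fun s hs => h s (hle s hs)
  refine AEIncluded.generateFrom ?_
  rintro _ ⟨Q, -, rfl⟩
  obtain ⟨a, b, c, d, -, -, hQbox, t, ht, hQt⟩ :=
    exists_ae_eq_of_thm_1_7 h17 hD hDc hμ {W} (by simpa using hW) Q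
  set box : Set ℂ := {z : ℂ | a < z.re ∧ z.re < b ∧ c < z.im ∧ z.im < d} with hbox
  set cbox : Set ℂ := {z : ℂ | a ≤ z.re ∧ z.re ≤ b ∧ c ≤ z.im ∧ z.im ≤ d} with hcbox
  -- the σ-fields of the drop-out lemma
  have hind : Indep (crossingField (D := D) (D ∩ box)) (crossingField (D := D) (D \ cbox))
      (μ : Measure (QuadConfig D)) :=
    indep_crossingField_of_disjoint hD hμ (hD.inter (isOpen_openBox a b c d))
      (hD.sdiff (isClosed_closedBox a b c d))
      (Set.disjoint_left.2 fun z hz hz' => hz'.2 ⟨hz.2.1.le, hz.2.2.1.le, hz.2.2.2.1.le,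
        hz.2.2.2.2.le⟩)
  have hG : crossingField (D := D) (D ∩ box ∩ interior W) ⊔
      crossingField (D := D) (D ∩ box ∩ interior Wᶜ) ≤ crossingField (D := D) (D ∩ box) :=
    sup_le (crossingField_mono inter_subset_left) (crossingField_mono inter_subset_left)
  have hE : ((⨆ V ∈ ({W} : Finset (Set ℂ)), crossingField (D := D) (D ∩ box ∩ interior V)) ⊔
        crossingField (D := D) (D ∩ box ∩ ⋂ V ∈ ({W} : Finset (Set ℂ)), interior Vᶜ)) ⊔
      crossingField (D := D) (D \ cbox) ≤
      (crossingField (D := D) (D ∩ box ∩ interior W) ⊔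
        crossingField (D := D) (D ∩ box ∩ interior Wᶜ)) ⊔ crossingField (D := D) (D \ cbox) := by
    refine sup_le (sup_le (iSup₂_le fun V hV => ?_) ?_) le_sup_right
    · rw [Finset.mem_singleton] at hV
      subst hV
      exact le_sup_left.trans le_sup_left
    · refine le_trans (crossingField_mono ?_) (le_sup_right.trans le_sup_left)
      exact inter_subset_inter_right _ (biInter_subset_of_mem (Finset.mem_singleton_self W))
  obtain ⟨u, hu, hQu⟩ := exists_measurableSet_ae_eq_of_indep hG (crossingField_le _)
    (crossingField_le _) hind
    (measurableSet_crossingField_crossedEvent (subset_inter Q.carrier_subset hQbox)) (hE t ht) hQt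
  refine ⟨u, ?_, hQu⟩
  refine (sup_le_sup (crossingField_mono fun z hz => ?_) (crossingField_mono fun z hz => ?_)) u hu
  · rw [interior_inter, hD.interior_eq]
    exact ⟨hz.1.1, hz.2⟩
  · rw [interior_inter, hD.interior_eq]
    exact ⟨hz.1.1, hz.2⟩

/-- **The factorization of two members of the base from Thm. 1.7**: for `D` open connected, `μ`
a subsequential scaling limit and `V, W ∈ rectAlgebra`,
`𝓕_{int(D ∩ (V ∪ W))} ⊆ 𝓕_{int(D ∩ V)} ∨ 𝓕_{int(D ∩ W)}` up to `μ`-null sets (Thm. 1.7 for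
the cut along `∂V ∪ ∂W`, hypothesis 2 of `SchrammSmirnov2011_cor_1_8_black_of_noise`).  For a
quad `Q` inside `int(D ∩ (V ∪ W))` the engine (with `J = {V, W}`) puts `⊞_Q` a.e. into
`(𝓕_{D ∩ box ∩ int V} ∨ 𝓕_{D ∩ box ∩ int W}) ∨ (𝓕_{D ∩ box ∩ int Vᶜ ∩ int Wᶜ} ∨ 𝓕_{D ∖ box})`,
and the second group is the field of an open set disjoint from `D ∩ box ∩ int(V ∪ W) ⊇ [Q]`,
hence independent of its field and dropping out. [cite: SchrammSmirnov2011, Thm. 1.7 and Cor. 1.8] -/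
theorem aeIncluded_regionField_union_of_thm_1_7 (h17 : SchrammSmirnov2011_thm_1_7)
    (hD : IsOpen D) (hDc : IsConnected D) {μ : FiniteMeasure (QuadConfig D)}
    (hμ : IsSubseqQuadLimit D μ) {V W : Set ℂ} (hV : V ∈ rectAlgebra) (hW : W ∈ rectAlgebra) :
    AEIncluded (μ : Measure (QuadConfig D)) (regionField D (V ∪ W))
      (regionField D V ⊔ regionField D W) := by
  classical
  haveI : IsProbabilityMeasure (μ : Measure (QuadConfig D)) :=
    isProbabilityMeasure_of_isSubseqQuadLimit hD hμ
  refine AEIncluded.generateFrom ?_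
  rintro _ ⟨Q, hQ, rfl⟩
  have hJ : ∀ U ∈ ({V, W} : Finset (Set ℂ)), U ∈ rectAlgebra := by
    intro U hU
    rw [Finset.mem_insert, Finset.mem_singleton] at hU
    rcases hU with rfl | rfl
    exacts [hV, hW]
  obtain ⟨a, b, c, d, -, -, hQbox, t, ht, hQt⟩ := exists_ae_eq_of_thm_1_7 h17 hD hDc hμ {V, W} hJ Q
  -- notation-free abbreviations of the pieces
  set box : Set ℂ := {z : ℂ | a < z.re ∧ z.re < b ∧ c < z.im ∧ z.im < d} with hbox
  set cbox : Set ℂ := {z : ℂ | a ≤ z.re ∧ z.re ≤ b ∧ c ≤ z.im ∧ z.im ≤ d} with hcbox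
  have hbc : box ⊆ cbox := fun z hz => ⟨hz.1.le, hz.2.1.le, hz.2.2.1.le, hz.2.2.2.le⟩
  -- `[Q] ⊆ D ∩ box ∩ int (V ∪ W)`
  have hQA : Q.carrier ⊆ D ∩ box ∩ interior (V ∪ W) := by
    refine subset_inter (subset_inter Q.carrier_subset hQbox) ?_
    exact hQ.trans (interior_mono inter_subset_right)
  -- the independent complement: `(D ∩ box ∩ ⋂ int Uᶜ) ∪ (D ∖ cbox)`
  have hopen : IsOpen ((D ∩ box ∩ ⋂ U ∈ ({V, W} : Finset (Set ℂ)), interior Uᶜ) ∪ (D \ cbox)) :=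
    ((hD.inter (isOpen_openBox a b c d)).inter
      (isOpen_biInter_finset fun _ _ => isOpen_interior)).union
      (hD.sdiff (isClosed_closedBox a b c d))
  have hdisj : Disjoint (D ∩ box ∩ interior (V ∪ W))
      ((D ∩ box ∩ ⋂ U ∈ ({V, W} : Finset (Set ℂ)), interior Uᶜ) ∪ (D \ cbox)) := by
    refine Set.disjoint_left.2 fun z hz hz' => ?_
    rcases hz' with hz' | hz'
    · have hV' : z ∈ interior Vᶜ :=
        mem_iInter₂.1 hz'.2 V (Finset.mem_insert_self _ _)
      have hW' : z ∈ interior Wᶜ :=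
        mem_iInter₂.1 hz'.2 W (Finset.mem_insert_of_mem (Finset.mem_singleton_self _))
      rcases interior_subset hz.2 with h | h
      · exact interior_subset hV' h
      · exact interior_subset hW' h
    · exact hz'.2 (hbc hz.1.2)
  have hind : Indep (crossingField (D := D) (D ∩ box ∩ interior (V ∪ W)))
      (crossingField (D := D)
        ((D ∩ box ∩ ⋂ U ∈ ({V, W} : Finset (Set ℂ)), interior Uᶜ) ∪ (D \ cbox)))
      (μ : Measure (QuadConfig D)) :=
    indep_crossingField_of_disjoint hD hμ
      ((hD.inter (isOpen_openBox a b c d)).inter isOpen_interior) hopen hdisj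
  have hG : crossingField (D := D) (D ∩ box ∩ interior V) ⊔
      crossingField (D := D) (D ∩ box ∩ interior W) ≤
      crossingField (D := D) (D ∩ box ∩ interior (V ∪ W)) :=
    sup_le (crossingField_mono (inter_subset_inter_right _ (interior_mono subset_union_left)))
      (crossingField_mono (inter_subset_inter_right _ (interior_mono subset_union_right)))
  have hE : ((⨆ U ∈ ({V, W} : Finset (Set ℂ)), crossingField (D := D) (D ∩ box ∩ interior U)) ⊔
        crossingField (D := D) (D ∩ box ∩ ⋂ U ∈ ({V, W} : Finset (Set ℂ)), interior Uᶜ)) ⊔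
      crossingField (D := D) (D \ cbox) ≤
      (crossingField (D := D) (D ∩ box ∩ interior V) ⊔
        crossingField (D := D) (D ∩ box ∩ interior W)) ⊔
      crossingField (D := D)
        ((D ∩ box ∩ ⋂ U ∈ ({V, W} : Finset (Set ℂ)), interior Uᶜ) ∪ (D \ cbox)) := by
    refine sup_le (sup_le (iSup₂_le fun U hU => ?_) ?_) ?_
    · rw [Finset.mem_insert, Finset.mem_singleton] at hU
      rcases hU with rfl | rfl
      · exact le_sup_left.trans le_sup_left
      · exact le_sup_right.trans le_sup_left
    · exact (crossingField_mono subset_union_left).trans le_sup_right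
    · exact (crossingField_mono subset_union_right).trans le_sup_right
  obtain ⟨u, hu, hQu⟩ := exists_measurableSet_ae_eq_of_indep hG (crossingField_le _)
    (crossingField_le _) hind (measurableSet_crossingField_crossedEvent hQA) (hE t ht) hQt
  refine ⟨u, ?_, hQu⟩
  refine (sup_le_sup (crossingField_mono fun z hz => ?_) (crossingField_mono fun z hz => ?_)) u hu
  · rw [interior_inter, hD.interior_eq]
    exact ⟨hz.1.1, hz.2⟩
  · rw [interior_inter, hD.interior_eq]
    exact ⟨hz.1.1, hz.2⟩

/-- **Schramm–Smirnov 2011, Cor. 1.8 (Percolation is a noise) from Theorem 1.7**: given the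
named fact `SchrammSmirnov2011_thm_1_7` (Factorization), every subsequential scaling limit of
critical bond percolation on `ℤ²` in `ℋ_D` is a noise over the rectangle base — independence by
`indep_regionField_compl` (`QuadCrossingNoiseIndep.lean`), generation by
`aeIncluded_borel_regionField_sup_of_thm_1_7`. [cite: SchrammSmirnov2011, Cor. 1.8] -/
theorem SchrammSmirnov2011_cor_1_8_noise_of_thm_1_7 (h17 : SchrammSmirnov2011_thm_1_7) :
    SchrammSmirnov2011_cor_1_8_noise :=
  SchrammSmirnov2011_cor_1_8_noise_of_generation fun _ hD hDc _ hμ _ hW =>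
    aeIncluded_borel_regionField_sup_of_thm_1_7 h17 hD hDc hμ hW

open Literature.Probability.Independence in
/-- **Cor. 1.8 (black) from the factorization of adjacent pieces and the pivotal estimate.**
This is `SchrammSmirnov2011_cor_1_8_black_of_noise` (Tsirelson's Remark 8a2 argument, proved in
`QuadCrossingNoiseBlack.lean`) with its hypothesis 1 — the noise property, used there only through
its independence clause — discharged by `indep_regionField_compl`; hypotheses 2 (Thm. 1.7 for the
cut between two disjoint members of the base) and 3 (the cell-by-cell sandwich with
`Σ_C μ(A⁺_C ∖ A⁻_C)² ≤ ε²`, the four-arm / boundary three-arm bounds transported to the limit)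
remain. [cite: SchrammSmirnov2011, Cor. 1.8 (via Tsirelson2003 Remark 8a2)] -/
theorem SchrammSmirnov2011_cor_1_8_black_of_factorization
    (hfac : ∀ (D : Set ℂ), IsOpen D → IsConnected D →
      ∀ μ : FiniteMeasure (QuadConfig D), IsSubseqQuadLimit D μ →
        ∀ V ∈ rectAlgebra, ∀ W ∈ rectAlgebra, Disjoint V W →
          AEIncluded (μ : Measure (QuadConfig D)) (regionField D (V ∪ W))
            (regionField D V ⊔ regionField D W))
    (hpiv : ∀ (D : Set ℂ), IsOpen D → IsConnected D →
      ∀ μ : FiniteMeasure (QuadConfig D), IsSubseqQuadLimit D μ →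
        ∀ A ∈ generatePiSystem (range (QuadConfig.crossedEvent (D := D))), ∀ ε : ℝ, 0 < ε →
          ∃ s : Finset (Set ℂ), (∀ W ∈ s, W ∈ rectAlgebra) ∧
            (∀ V ∈ s, ∀ W ∈ s, V ≠ W → Disjoint V W) ∧ (⋃ W ∈ s, W) = univ ∧
            ∃ Am Ap : Set ℂ → Set (QuadConfig D),
              (∀ W ∈ s, MeasurableSet[regionField D Wᶜ] (Am W) ∧
                MeasurableSet[regionField D Wᶜ] (Ap W) ∧
                (∀ᵐ ω ∂(μ : Measure (QuadConfig D)), ω ∈ Am W → ω ∈ A) ∧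
                (∀ᵐ ω ∂(μ : Measure (QuadConfig D)), ω ∈ A → ω ∈ Ap W)) ∧
              ∑ W ∈ s, ((μ : Measure (QuadConfig D)).real (Ap W \ Am W)) ^ 2 ≤ ε ^ 2) :
    SchrammSmirnov2011_cor_1_8_black := by
  classical
  intro D hD hDc μ hμ f hf hchaos
  have hne : D.Nonempty := hDc.nonempty
  haveI : IsProbabilityMeasure (μ : Measure (QuadConfig D)) :=
    isProbabilityMeasure_of_isSubseqQuadLimit hD hμ
  have hgen := borel_eq_generateFrom_generatePiSystem_crossedEvent hD hne
  have hle : ∀ W : Set ℂ, regionField D W ≤ (QuadConfig.instMeasurableSpace :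
      MeasurableSpace (QuadConfig D)) := fun W => crossingField_le _
  have hind : ∀ W : Set ℂ,
      Indep (regionField D W) (regionField D Wᶜ) (μ : Measure (QuadConfig D)) :=
    fun W => indep_regionField_compl hD hμ W
  have hf0 : ∫ ω, f ω ∂(μ : Measure (QuadConfig D)) = 0 :=
    integral_eq_zero_of_ae_eq_condExp_add (hle univ) (hle univᶜ)
      (hchaos univ univ_mem_rectAlgebra)
  refine ae_eq_zero_of_forall_exists_cellDecomposition (fun W => regionField D W)
    (fun W => regionField D Wᶜ) hgen (isPiSystem_generatePiSystem _) hf hf0 ?_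
  intro A hA ε hε
  obtain ⟨s, hs𝒜, hdisj, hcover, Am, Ap, hsand, hsum⟩ := hpiv D hD hDc μ hμ A hA ε hε
  refine ⟨s, fun W _ => ⟨hle W, hle Wᶜ, hind W⟩, ?_, Am, Ap, hsand, hsum⟩
  have hdec := (ae_eq_sum_condExp_of_firstChaos (μ := (μ : Measure (QuadConfig D)))
    isSetAlgebra_rectAlgebra (fun W => regionField D W) (fun W _ => hle W)
    (fun V _ W _ hVW => regionField_mono D hVW) (fun W _ => hind W)
    (fun V hV W hW hVW => hfac D hD hDc μ hμ V hV W hW hVW) (regionField_empty D) hchaos id s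
    (fun W hW => hs𝒜 W hW) hdisj (by simpa using hcover)).1
  simpa using hdec


/-- **Schramm–Smirnov 2011, Cor. 1.8 "it has to be a black noise" from Theorem 1.7 and the
pivotal estimate.**  Of the three inputs of Tsirelson's Remark 8a2 argument
(`SchrammSmirnov2011_cor_1_8_black_of_noise`): the noise property's independence clause is
PROVED (`indep_regionField_compl`), the factorization of adjacent pieces follows from the named
fact `SchrammSmirnov2011_thm_1_7` (`aeIncluded_regionField_union_of_thm_1_7`), and what remains
is the pivotal estimate `hpiv` — for every finite intersection of crossing events and `ε > 0`, a
finite partition of the plane into members `C` of the base with sandwiches `A⁻_C ⊆ A ⊆ A⁺_C` in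
`𝓕_{int(D ∖ C)}` and `Σ_C μ(A⁺_C ∖ A⁻_C)² ≤ ε²` ("the critical exponent for a small cell of size
`ε × ε` being pivotal … `o(ε)`", Tsirelson 2003, Remark 8a2; for bond percolation on `ℤ²` the
four-arm bound of Garban's Appendix B to the source, transported to the limit).
[cite: SchrammSmirnov2011, Cor. 1.8 (via Thm. 1.7 and Tsirelson2003 Remark 8a2)] -/
theorem SchrammSmirnov2011_cor_1_8_black_of_thm_1_7 (h17 : SchrammSmirnov2011_thm_1_7)
    (hpiv : ∀ (D : Set ℂ), IsOpen D → IsConnected D →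
      ∀ μ : FiniteMeasure (QuadConfig D), IsSubseqQuadLimit D μ →
        ∀ A ∈ generatePiSystem (range (QuadConfig.crossedEvent (D := D))), ∀ ε : ℝ, 0 < ε →
          ∃ s : Finset (Set ℂ), (∀ W ∈ s, W ∈ rectAlgebra) ∧
            (∀ V ∈ s, ∀ W ∈ s, V ≠ W → Disjoint V W) ∧ (⋃ W ∈ s, W) = univ ∧
            ∃ Am Ap : Set ℂ → Set (QuadConfig D),
              (∀ W ∈ s, MeasurableSet[regionField D Wᶜ] (Am W) ∧
                MeasurableSet[regionField D Wᶜ] (Ap W) ∧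
                (∀ᵐ ω ∂(μ : Measure (QuadConfig D)), ω ∈ Am W → ω ∈ A) ∧
                (∀ᵐ ω ∂(μ : Measure (QuadConfig D)), ω ∈ A → ω ∈ Ap W)) ∧
              ∑ W ∈ s, ((μ : Measure (QuadConfig D)).real (Ap W \ Am W)) ^ 2 ≤ ε ^ 2) :
    SchrammSmirnov2011_cor_1_8_black :=
  SchrammSmirnov2011_cor_1_8_black_of_factorization
    (fun _ hD hDc _ hμ _ hV _ hW _ => aeIncluded_regionField_union_of_thm_1_7 h17 hD hDc hμ hV hW)
    hpiv

end QuadCrossing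

end Literature.Probability.Percolation
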